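import Summits.QuantumFields.BalabanUV.Beta.WilsonBiStencilWardTrace
import Summits.QuantumFields.BalabanUV.Beta.WilsonDivergenceContact

/-!
# The (T2-S₂) Wilson table law at level 0 ON `ℤ^{d+1}` IN THE PACKED CURRENCY: the background divergence of an3's Wilson bi-stencil
# `wilsonW₂ d (wsym22 N)` is `4N²` times the commutator of an2's `wilsonA` with the site indicator — NO remainder
# (β sub-cell, row D1, (L4) W-side, Ward twin of (W-LET-S₂)₀; D1 formalisation swarm seat `b2b-balaban-beta-d1-formalise-leaf-09`, gen 4;
# CLAIM «D1-hW-L4-W22-TABLE-WARD», file 4)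

HONEST FRAMING (cell charter, verbatim): «discharging `BetaPertH` makes Bałaban's UV stability UNCONDITIONAL — a real
constructive-QFT result; it is NOT the continuum limit and NOT the Clay problem.»  HONEST DEPENDENCY (cell records, verbatim):
«continuum YM on T⁴ ⇐ BetaPertH ∧ nine spine estimates (0/9 proved); BetaPertH ⇐ (D1) ∧ (D4) ∧ CAP+tail; G-an2-4 gates asym, D1 and
NE2/3/4.»  DERIVED cell leaf: finite algebra, no estimate, no limit, nothing cited — every statement is kernel-proved here ([folklore]); no
`[cite:]` tag, no `def … : Prop`; the two `def`s (`DIdx₂`, `dpts₂`) are the finite window of the transfer, asserting nothing.  By itself this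
file instantiates NO binder of the β-function wall.  NOT D1, NOT `BetaPertH`, NOT continuum, NOT Clay.
ABSOLUTE RULE (cell charter, verbatim): «No internally-minted statement may enter as a cited fact. Every hypothesis is either
kernel-proved in this package or a verbatim quotation of a PUBLISHED theorem with page reference. The manuscript(s) under audit are
NOT citable for their own disputed steps — they are the thing under adjudication; programme-internal (2001/route/tribunal) claims are
never citable.»

## What

File 3 (`WilsonBiStencilWardTrace.bgWard22_traced_div`) is the traced law on every FINITE lattice for the four-term symmetrisation
`W22tr` of an3's colour-traced two-bond table `bondPairTab (w22 N)`.  §1: by an3's slot-swap lemmas (`bondPairTab_swap`,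
`bondPairTab_transpose`, `symTab_w22`) that four-term sum IS `bondPairTab (wsym22 N)` with the varied bond FIRST (`W22tr_eq_bondPairTab_wsym22`),
so the finite-lattice law reads `Σ_μ (BPT e (u,μ) (u′,κ′) wsym22 − BPT e (u−e_μ,μ) (u′,κ′) wsym22)(p,q) = −4N²·([q.1 = u] − [p.1 = u])·S₀A e u′ κ′ p q`
(`bgWard22_traced_div_wsym22`).  §2: NATURALITY of an3's two-bond table under additive maps injective on a finite window (`off_map`,
`plaqTab_map`, `bondPairTab_map`) — the (2,2) companion of leaf-05-g2's `WilsonStencilTransport.wilsonStencil₀_map`.  §3: the TRANSFER to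
`ℤ^{d+1}` along `castVec (dmod₂ + 1)` (pattern of `WilsonDivergenceContact.S₀A_div_Z`): **`wEntry₂_wsym22_div_Z`** — for every `d`, every `N ≠ 0`
carrying a complete tr-orthonormal generator family, every background bond `(u′,κ′)`, site `u` and legs `(x,α)`, `(z,β)` of `ℤ^{d+1}`:
`Σ_μ (wEntry₂ d (wsym22 N) μ (u − e_μ) κ′ u′ x z α β − wEntry₂ d (wsym22 N) μ u κ′ u′ x z α β) = 4N²·([z = u] − [x = u])·S₀A unitVec u′ κ′ (x,α) (z,β)`.
§4: THE PACKED LAW — entrywise on all four blocks and **`divV_wilsonW₂_wsym22_eq_conjV`**: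
`divV (fun κ u ↦ wilsonW₂ d (wsym22 N) κ u κ′ u′) u = (4·N²) • conjV (wilsonA d κ′ u′) (diagK (legInd ρ u))` for every root `ρ`
(`KernelWard.divV`, `ChartConjugation.conjV`, `BorderedHessian.diagK`, `AveragingWardRootedStencils.legInd`; `WilsonReflectionContact.wilsonA_inl_inl`),
and the block form `sum_divV_wilsonW₂_wsym22_eq_conjV` — the hW socket `hS₂` of leaf-10's `KernelWardSymAssembly` for the WILSON LETTER of the
level-0 bi-table, with REMAINDER ZERO and no second-order generator, the coefficient `4N²` decided by the kernel (against an2's `wilsonA`, whose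
own Ward coefficient is `½`, `WilsonDivergenceContact.divV_wilsonA_eq_conjV`).
HYPOTHESES KEPT: `τ : C → Matrix (Fin N) (Fin N) ℂ` complete and tr-orthonormal (`ColourTrace`; in the tree for `N = 2` by `pauli`), `N ≠ 0`,
`C` nonempty — the conclusion does not mention `τ`; which multiple of `wsym22 N` is the (L4-D) literal's `T` and the matching of `4N²` with
`cE₂/cE` is the units/colour owners' pin ((R45)/(P6)), NOT asserted here.
Provenance: pub-balaban β sub-cell, D1 formalisation swarm, unit `b2b-balaban-beta-d1-formalise-leaf-09` gen 4, 2026-08-20 (v1); over files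
1–3, leaf-05-g2's `WilsonStencilTransport` / `WilsonDivergenceContact` and an3's `WilsonVertex2Sym` / `WilsonBiStencil` BY NAME; no existing file touched.
-/

namespace Summit.QuantumFields.BalabanUV.Beta.WilsonBiStencilWardZ

open Finset
open scoped BigOperators Matrix
open Literature.MathematicalPhysics.QuantumFieldTheory.Balaban1983to89
open Literature.MathematicalPhysics.QuantumFieldTheory.Balaban1983to89.Beta
open ColourTrace (Complete TrOrthonormal)
open PlaquetteStencilData (WilsonIdx wα wβ)
open PlaquetteVertex2Stencil (off dir)
open PlaquetteVertex2Trace (w22)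
open WilsonVertex2Kron (plaqTab plaqTab_apply cellTab bondPairTab bondPairTab_add ite_apply₂)
open WilsonVertex2Sym (swapIJ swapKL symTab symTab_w22 wsym22 bondPairTab_swap bondPairTab_transpose)
open WilsonBiStencil (wEntry₂ wilsonW₂ wilsonW₂_inl_inl wilsonW₂_inl_inr wilsonW₂_inr_inl wilsonW₂_inr_inr)
open StepJetData (wilsonA)
open ExpKernelCalculus (MKer)
open OneStepResolventKernel (Fib)
open KernelWard (divV)
open B6BondElimination (unitVec)
open AffineAveraging (box toSite)
open Summit.QuantumFields.BalabanUV.Beta.ChartConjugation (conjV)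
open Summit.QuantumFields.BalabanUV.Beta.BorderedHessian (diagK conjV_diagK_apply)
open Summit.QuantumFields.BalabanUV.Beta.AveragingWardRootedStencils (legInd legInd_inl)
open Summit.QuantumFields.BalabanUV.Beta.WilsonReflectionFrame (S₀A)
open Summit.QuantumFields.BalabanUV.Beta.WilsonStencilTransport (S₀A_map castVec castVec_injOn)
open Summit.QuantumFields.BalabanUV.Beta.WilsonReflectionContact (wilsonA_inl_inl wilsonA_inl_inr wilsonA_inr_inl wilsonA_inr_inr)
open Summit.QuantumFields.BalabanUV.Beta.WardLocusStencils (divV_apply)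
open Summit.QuantumFields.BalabanUV.Beta.WardLocusS0N (conjV_diagK_sum)
open Summit.QuantumFields.BalabanUV.Beta.WilsonBiStencilWardTrace (bgWard22_traced_div)

/-! ## §1 The four-term symmetrisation is the table `wsym22`, varied bond first -/

section Sym

variable {Λ : Type*} [DecidableEq Λ] [AddCommGroup Λ] {D : Type*} [Fintype D] [DecidableEq D]

/-- [folklore] the slot bookkeeping: `swapKL T + T + swapKL (swapIJ T) + swapIJ T = symTab T`. -/
theorem swap_sum_eq_symTab (T : Fin 4 → Fin 4 → Fin 4 → Fin 4 → ℝ) :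
    (fun i j k l => swapKL T i j k l + T i j k l + swapKL (swapIJ T) i j k l + swapIJ T i j k l) = symTab T := by
  funext i j k l
  simp only [swapKL, swapIJ, symTab]
  ring

/-- [folklore] **THE FOUR-TERM SYMMETRISATION OF THE TWO-BOND TABLE IS THE TABLE OF `symTab`, VARIED BOND FIRST** (an3's `bondPairTab_swap` /
`bondPairTab_transpose` / `bondPairTab_add`). -/
theorem bondPairTab_fourTerm (e : D → Λ) (u' : Λ) (κ' : D) (x' : Λ) (μ : D) (T : Fin 4 → Fin 4 → Fin 4 → Fin 4 → ℝ) (p q : Λ × D) :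
    bondPairTab e u' κ' x' μ T p q + bondPairTab e x' μ u' κ' T p q + bondPairTab e u' κ' x' μ T q p + bondPairTab e x' μ u' κ' T q p =
      bondPairTab e x' μ u' κ' (symTab T) p q := by
  have h1 : bondPairTab e u' κ' x' μ T p q = bondPairTab e x' μ u' κ' (swapKL T) p q := by rw [bondPairTab_swap]
  have h3 : bondPairTab e u' κ' x' μ T q p = bondPairTab e x' μ u' κ' (swapKL (swapIJ T)) p q := by
    rw [← Matrix.transpose_apply (bondPairTab e u' κ' x' μ T) p q, bondPairTab_transpose, bondPairTab_swap]
  have h4 : bondPairTab e x' μ u' κ' T q p = bondPairTab e x' μ u' κ' (swapIJ T) p q := by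
    rw [← Matrix.transpose_apply (bondPairTab e x' μ u' κ' T) p q, bondPairTab_transpose]
  rw [h1, h3, h4, ← swap_sum_eq_symTab]
  rw [show (fun i j k l => swapKL T i j k l + T i j k l + swapKL (swapIJ T) i j k l + swapIJ T i j k l) =
      fun i j k l => ((fun i j k l => swapKL T i j k l + T i j k l) i j k l + swapKL (swapIJ T) i j k l) + swapIJ T i j k l from rfl,
    bondPairTab_add, bondPairTab_add, Matrix.add_apply, Matrix.add_apply,
    show (fun i j k l => swapKL T i j k l + T i j k l) = fun i j k l => swapKL T i j k l + T i j k l from rfl, bondPairTab_add, Matrix.add_apply]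

variable [Fintype Λ]

open scoped Matrix.Norms.Operator in
/-- [folklore] **THE TRACED LAW FOR `wsym22`, VARIED BOND FIRST** (file 3's `bgWard22_traced_div` + §1): on every finite lattice,
`Σ_μ (BPT e (u,μ) (u′,κ′) wsym22 − BPT e (u − e_μ, μ) (u′,κ′) wsym22)((x,α),(z,β)) = −(4·N²)·([z = u] − [x = u])·S₀A e u′ κ′ (x,α) (z,β)`. -/
theorem bgWard22_traced_div_wsym22 {N : ℕ} {C : Type*} [Fintype C] [DecidableEq C] {τ : C → Matrix (Fin N) (Fin N) ℂ} (hτ : Complete τ)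
    (ho : TrOrthonormal τ) (hN : N ≠ 0) (c : C) (e : D → Λ) (u' : Λ) (κ' : D) (u : Λ) (x : Λ) (α : D) (z : Λ) (β : D) :
    ∑ μ : D, (bondPairTab e u μ u' κ' (wsym22 N) (x, α) (z, β) - bondPairTab e (u - e μ) μ u' κ' (wsym22 N) (x, α) (z, β)) =
      -(4 * (N : ℝ) ^ 2) * ((if z = u then (1 : ℝ) else 0) - (if x = u then 1 else 0)) * S₀A e u' κ' (x, α) (z, β) := by
  rw [← bgWard22_traced_div hτ ho hN c e u' κ' u x α z β]
  refine Finset.sum_congr rfl fun μ _ => ?_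
  rw [bondPairTab_fourTerm, bondPairTab_fourTerm, symTab_w22]

end Sym

/-! ## §2 Naturality of the two-bond table under additive maps injective on a window -/

section Naturality

variable {Λ Λ' : Type*} [DecidableEq Λ] [AddCommGroup Λ] [DecidableEq Λ'] [AddCommGroup Λ'] {D : Type*} [Fintype D] [DecidableEq D]

omit [DecidableEq Λ] [DecidableEq Λ'] [Fintype D] [DecidableEq D] in
/-- [folklore] the plaquette offsets are natural. -/
theorem off_map (f : Λ →+ Λ') (e : D → Λ) (μ ν : D) (i : Fin 4) : off (⇑f ∘ e) μ ν i = f (off e μ ν i) := by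
  fin_cases i <;> simp [off]

omit [Fintype D] in
/-- [folklore] **TRANSPORT OF THE COLOURLESS PLAQUETTE STENCIL**: an additive `f` injective on a set containing the two legs and the four
plaquette sites does not change the entries. -/
theorem plaqTab_map (f : Λ →+ Λ') {S : Set Λ} (hS : Set.InjOn f S) (e : D → Λ) (x₀ : Λ) (μ ν : D) (T₂ : Fin 4 → Fin 4 → ℝ) {x z : Λ}
    (hx : x ∈ S) (hz : z ∈ S) (h₀ : ∀ i, x₀ + off e μ ν i ∈ S) (α β : D) :
    plaqTab (⇑f ∘ e) (f x₀) μ ν T₂ (f x, α) (f z, β) = plaqTab e x₀ μ ν T₂ (x, α) (z, β) := by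
  simp only [plaqTab_apply, off_map, ← map_add, hS.eq_iff hx (h₀ _), hS.eq_iff hz (h₀ _)]

/-- [folklore] **TRANSPORT OF THE COLOURLESS TWO-BOND TABLE**: an additive `f` injective on a set containing the two legs, the second bond's
site and every `u₁ − off k + off l` does not change the entries (the (2,2) companion of `WilsonStencilTransport.wilsonStencil₀_map`). -/
theorem bondPairTab_map (f : Λ →+ Λ') {S : Set Λ} (hS : Set.InjOn f S) (e : D → Λ) (u₁ : Λ) (κ₁ : D) (u₂ : Λ) (κ₂ : D)
    (T : Fin 4 → Fin 4 → Fin 4 → Fin 4 → ℝ) {x z : Λ} (hx : x ∈ S) (hz : z ∈ S) (hu₂ : u₂ ∈ S)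
    (hkl : ∀ (μ ν : D) (k l : Fin 4), u₁ - off e μ ν k + off e μ ν l ∈ S) (α β : D) :
    bondPairTab (⇑f ∘ e) (f u₁) κ₁ (f u₂) κ₂ T (f x, α) (f z, β) = bondPairTab e u₁ κ₁ u₂ κ₂ T (x, α) (z, β) := by
  simp only [bondPairTab, Matrix.sum_apply]
  refine Finset.sum_congr rfl fun μ _ => Finset.sum_congr rfl fun ν _ => Finset.sum_congr rfl fun k _ =>
    Finset.sum_congr rfl fun l _ => ?_
  simp only [cellTab, ite_apply₂, off_map, ← map_sub, ← map_add, hS.eq_iff (hkl μ ν k l) hu₂]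
  split_ifs with h
  · exact plaqTab_map f hS e (u₁ - off e μ ν k) μ ν _ hx hz (fun i => hkl μ ν k i) α β
  · rfl

end Naturality

/-! ## §3 The transfer to `ℤ^{d+1}` -/

section Transfer

variable {d : ℕ}

/-- index type of the finite window of the transfer.  A definition asserting nothing. [folklore] -/
abbrev DIdx₂ (d : ℕ) : Type :=
  Fin 4 ⊕ ((Fin (d + 1) × Fin (d + 1) × Fin 4 × Fin 4) ⊕ (Fin (d + 1) × Fin (d + 1) × Fin (d + 1) × Fin 4 × Fin 4))
    ⊕ (WilsonIdx (Fin (d + 1)) ⊕ WilsonIdx (Fin (d + 1)))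

/-- THE FINITE WINDOW OF SITES of the transfer for the background bond `(u′, κ′)`, the varied site `u` and the legs `x`, `z`: those four
sites, the plaquette points `u − off k + off l` and `(u − e_{μ₀}) − off k + off l` of the varied bonds, and the first-order supports
`u′ + wα κ′ i`, `u′ + wβ κ′ i`.  A definition asserting nothing. [folklore] -/
def dpts₂ (κ' : Fin (d + 1)) (u u' x z : Fin (d + 1) → ℤ) : DIdx₂ d → (Fin (d + 1) → ℤ)
  | Sum.inl 0 => x
  | Sum.inl 1 => z
  | Sum.inl 2 => u
  | Sum.inl 3 => u'
  | Sum.inr (Sum.inl (Sum.inl (μ, ν, k, l))) => u - off unitVec μ ν k + off unitVec μ ν l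
  | Sum.inr (Sum.inl (Sum.inr (μ₀, μ, ν, k, l))) => u - unitVec μ₀ - off unitVec μ ν k + off unitVec μ ν l
  | Sum.inr (Sum.inr (Sum.inl i)) => u' + wα unitVec κ' i
  | Sum.inr (Sum.inr (Sum.inr i)) => u' + wβ unitVec κ' i

/-- THE MODULUS of the transfer torus (one is added when used).  A definition asserting nothing. [folklore] -/
def dmod₂ (κ' : Fin (d + 1)) (u u' x z : Fin (d + 1) → ℤ) : ℕ :=
  ∑ i, ∑ i', ∑ j, (dpts₂ κ' u u' x z i j - dpts₂ κ' u u' x z i' j).natAbs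

open scoped Matrix.Norms.Operator in
/-- [folklore] **THE (T2-S₂) WILSON TABLE LAW ON `ℤ^{d+1}`** (frame `unitVec`; the torus law `bgWard22_traced_div_wsym22` on
`(ZMod (dmod₂+1))^{d+1}` pulled back along `castVec`): for every background bond `(u′, κ′)`, site `u` and legs `(x,α)`, `(z,β)`,
`Σ_μ (wEntry₂ d (wsym22 N) μ (u − e_μ) κ′ u′ x z α β − wEntry₂ d (wsym22 N) μ u κ′ u′ x z α β) = 4N²·([z = u] − [x = u])·S₀A unitVec u′ κ′ (x,α) (z,β)`. -/
theorem wEntry₂_wsym22_div_Z {N : ℕ} {C : Type*} [Fintype C] [DecidableEq C] {τ : C → Matrix (Fin N) (Fin N) ℂ} (hτ : Complete τ)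
    (ho : TrOrthonormal τ) (hN : N ≠ 0) (c : C) (u' : Fin (d + 1) → ℤ) (κ' : Fin (d + 1)) (u x z : Fin (d + 1) → ℤ) (α β : Fin (d + 1)) :
    ∑ μ : Fin (d + 1), (wEntry₂ d (wsym22 N) μ (u - unitVec μ) κ' u' x z α β - wEntry₂ d (wsym22 N) μ u κ' u' x z α β) =
      4 * (N : ℝ) ^ 2 * ((if z = u then (1 : ℝ) else 0) - (if x = u then 1 else 0)) * S₀A unitVec u' κ' (x, α) (z, β) := by
  set M : ℕ := dmod₂ κ' u u' x z + 1 with hM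
  have hS : Set.InjOn (castVec M) (Set.range (dpts₂ κ' u u' x z)) := castVec_injOn (dpts₂ κ' u u' x z)
  have key := bgWard22_traced_div_wsym22 (Λ := Fin (d + 1) → ZMod M) hτ ho hN c (⇑(castVec M) ∘ unitVec) (castVec M u') κ'
    (castVec M u) (castVec M x) α (castVec M z) β
  have mx : x ∈ Set.range (dpts₂ κ' u u' x z) := ⟨Sum.inl 0, rfl⟩
  have mz : z ∈ Set.range (dpts₂ κ' u u' x z) := ⟨Sum.inl 1, rfl⟩
  have mu : u ∈ Set.range (dpts₂ κ' u u' x z) := ⟨Sum.inl 2, rfl⟩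
  have mu' : u' ∈ Set.range (dpts₂ κ' u u' x z) := ⟨Sum.inl 3, rfl⟩
  have m₁ : ∀ (μ ν : Fin (d + 1)) (k l : Fin 4), u - off unitVec μ ν k + off unitVec μ ν l ∈ Set.range (dpts₂ κ' u u' x z) :=
    fun μ ν k l => ⟨Sum.inr (Sum.inl (Sum.inl (μ, ν, k, l))), rfl⟩
  have m₂ : ∀ (μ₀ μ ν : Fin (d + 1)) (k l : Fin 4),
      u - unitVec μ₀ - off unitVec μ ν k + off unitVec μ ν l ∈ Set.range (dpts₂ κ' u u' x z) :=
    fun μ₀ μ ν k l => ⟨Sum.inr (Sum.inl (Sum.inr (μ₀, μ, ν, k, l))), rfl⟩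
  have mα : ∀ i, u' + wα unitVec κ' i ∈ Set.range (dpts₂ κ' u u' x z) := fun i => ⟨Sum.inr (Sum.inr (Sum.inl i)), rfl⟩
  have mβ : ∀ i, u' + wβ unitVec κ' i ∈ Set.range (dpts₂ κ' u u' x z) := fun i => ⟨Sum.inr (Sum.inr (Sum.inr i)), rfl⟩
  have hsub : ∀ μ, castVec M u - (⇑(castVec M) ∘ unitVec) μ = castVec M (u - unitVec μ) := fun μ => by
    rw [Function.comp_apply, map_sub]
  have h₁ : ∀ μ, bondPairTab (⇑(castVec M) ∘ unitVec) (castVec M u) μ (castVec M u') κ' (wsym22 N) (castVec M x, α) (castVec M z, β) =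
      bondPairTab unitVec u μ u' κ' (wsym22 N) (x, α) (z, β) :=
    fun μ => bondPairTab_map _ hS unitVec u μ u' κ' _ mx mz mu' m₁ α β
  have h₂ : ∀ μ, bondPairTab (⇑(castVec M) ∘ unitVec) (castVec M (u - unitVec μ)) μ (castVec M u') κ' (wsym22 N) (castVec M x, α)
      (castVec M z, β) = bondPairTab unitVec (u - unitVec μ) μ u' κ' (wsym22 N) (x, α) (z, β) :=
    fun μ => bondPairTab_map _ hS unitVec (u - unitVec μ) μ u' κ' _ mx mz mu' (m₂ μ) α β
  have h₃ : S₀A (⇑(castVec M) ∘ unitVec) (castVec M u') κ' (castVec M x, α) (castVec M z, β) = S₀A unitVec u' κ' (x, α) (z, β) :=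
    S₀A_map _ hS unitVec u' κ' mx mz mα mβ α β
  simp only [hsub, h₁, h₂, h₃, hS.eq_iff mz mu, hS.eq_iff mx mu] at key
  -- `wEntry₂` is the two-bond table with frame `unitVec`; the sign flips with the order of the difference
  have e : ∀ μ, wEntry₂ d (wsym22 N) μ (u - unitVec μ) κ' u' x z α β - wEntry₂ d (wsym22 N) μ u κ' u' x z α β =
      -(bondPairTab unitVec u μ u' κ' (wsym22 N) (x, α) (z, β) - bondPairTab unitVec (u - unitVec μ) μ u' κ' (wsym22 N) (x, α) (z, β)) :=
    fun μ => by unfold wEntry₂; ring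
  simp only [e, Finset.sum_neg_distrib, key]
  ring

end Transfer

/-! ## §4 The packed law: `divV (κ u ↦ wilsonW₂ d (wsym22 N) κ u κ′ u′) u = (4N²) • conjV (wilsonA d κ′ u′) (diagK (legInd ρ u))` -/

section Law

variable {d : ℕ} {N : ℕ} {C : Type*} [Fintype C] [DecidableEq C] {τ : C → Matrix (Fin N) (Fin N) ℂ}

/-- [folklore] **THE FIELD–FIELD ENTRY**: `divV (κ u ↦ wilsonW₂ d (wsym22 N) κ u κ′ u′) u x z (inl α) (inl β)
= 4N²·([z = u] − [x = u])·wilsonA d κ′ u′ x z (inl α) (inl β)`. -/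
theorem divV_wilsonW₂_wsym22_inl_inl (hτ : Complete τ) (ho : TrOrthonormal τ) (hN : N ≠ 0) (c : C) (u' : Fin (d + 1) → ℤ)
    (κ' : Fin (d + 1)) (u x z : Fin (d + 1) → ℤ) (α β : Fin (d + 1)) :
    divV (fun κ u => wilsonW₂ d (wsym22 N) κ u κ' u') u x z (Sum.inl α) (Sum.inl β) =
      4 * (N : ℝ) ^ 2 * ((if z = u then (1 : ℝ) else 0) - (if x = u then 1 else 0)) * wilsonA d κ' u' x z (Sum.inl α) (Sum.inl β) := by
  rw [divV_apply, wilsonA_inl_inl]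
  simp only [wilsonW₂_inl_inl]
  exact wEntry₂_wsym22_div_Z hτ ho hN c u' κ' u x z α β

omit [Fintype C] [DecidableEq C] in
/-- [folklore] the field–multiplier entry of the divergence vanishes. -/
theorem divV_wilsonW₂_inl_inr (T : Fin 4 → Fin 4 → Fin 4 → Fin 4 → ℝ) (u' : Fin (d + 1) → ℤ) (κ' : Fin (d + 1))
    (u x z : Fin (d + 1) → ℤ) (α β : Fin (d + 1)) :
    divV (fun κ u => wilsonW₂ d T κ u κ' u') u x z (Sum.inl α) (Sum.inr β) = 0 := by
  rw [divV_apply]; simp only [wilsonW₂_inl_inr, sub_self, Finset.sum_const_zero]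

omit [Fintype C] [DecidableEq C] in
/-- [folklore] the multiplier–field entry of the divergence vanishes. -/
theorem divV_wilsonW₂_inr_inl (T : Fin 4 → Fin 4 → Fin 4 → Fin 4 → ℝ) (u' : Fin (d + 1) → ℤ) (κ' : Fin (d + 1))
    (u x z : Fin (d + 1) → ℤ) (α β : Fin (d + 1)) :
    divV (fun κ u => wilsonW₂ d T κ u κ' u') u x z (Sum.inr α) (Sum.inl β) = 0 := by
  rw [divV_apply]; simp only [wilsonW₂_inr_inl, sub_self, Finset.sum_const_zero]

omit [Fintype C] [DecidableEq C] in
/-- [folklore] the multiplier–multiplier entry of the divergence vanishes. -/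
theorem divV_wilsonW₂_inr_inr (T : Fin 4 → Fin 4 → Fin 4 → Fin 4 → ℝ) (u' : Fin (d + 1) → ℤ) (κ' : Fin (d + 1))
    (u x z : Fin (d + 1) → ℤ) (α β : Fin (d + 1)) :
    divV (fun κ u => wilsonW₂ d T κ u κ' u') u x z (Sum.inr α) (Sum.inr β) = 0 := by
  rw [divV_apply]; simp only [wilsonW₂_inr_inr, sub_self, Finset.sum_const_zero]

/-- [folklore] **HEADLINE — THE (T2-S₂) WILSON TABLE LAW AT LEVEL 0, PACKED CURRENCY, COMMUTATOR FORM**: for every root `ρ` and site `u`,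
`divV (κ u ↦ wilsonW₂ d (wsym22 N) κ u κ′ u′) u = (4·N²) • conjV (wilsonA d κ′ u′) (diagK (legInd ρ u))` — the background divergence (in its
first bond) of an3's Wilson bi-stencil with the symmetrised colour-traced table is the commutator of an2's first-order Wilson table with the
generator of the gauge rotation at `u`; NO remainder, NO second-order generator. -/
theorem divV_wilsonW₂_wsym22_eq_conjV (hτ : Complete τ) (ho : TrOrthonormal τ) (hN : N ≠ 0) (c : C) (ρ : Fin (d + 1) → ℤ)
    (u' : Fin (d + 1) → ℤ) (κ' : Fin (d + 1)) (u : Fin (d + 1) → ℤ) :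
    divV (fun κ u => wilsonW₂ d (wsym22 N) κ u κ' u') u = (4 * (N : ℝ) ^ 2) • conjV (wilsonA d κ' u') (diagK (legInd ρ u)) := by
  funext x z a b
  rw [Pi.smul_apply, Pi.smul_apply, Pi.smul_apply, Pi.smul_apply, smul_eq_mul, conjV_diagK_apply]
  rcases a with a | a <;> rcases b with b | b
  · rw [divV_wilsonW₂_wsym22_inl_inl hτ ho hN c, legInd_inl, legInd_inl]
    ring
  · rw [divV_wilsonW₂_inl_inr, wilsonA_inl_inr, zero_mul, mul_zero]
  · rw [divV_wilsonW₂_inr_inl, wilsonA_inr_inl, zero_mul, mul_zero]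
  · rw [divV_wilsonW₂_inr_inr, wilsonA_inr_inr, zero_mul, mul_zero]

/-- [folklore] **THE BLOCK (or any finitely smeared) FORM**: `Σ_{i ∈ s} divV (κ u ↦ wilsonW₂ d (wsym22 N) κ u κ′ u′) (U i)
= (4·N²) • conjV (wilsonA d κ′ u′) (diagK (Σ_{i ∈ s} legInd ρ (U i)))` (leaf-10's `WardLocusS0N.conjV_diagK_sum`) — the `hS₂` row of
leaf-10's `KernelWardSymAssembly.divW_W2SymOfK_eq_conjV_add_residuals` for the Wilson letter, remainder `R = 0`. -/
theorem sum_divV_wilsonW₂_wsym22_eq_conjV (hτ : Complete τ) (ho : TrOrthonormal τ) (hN : N ≠ 0) (c : C) {ι : Type*} (s : Finset ι)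
    (U : ι → Fin (d + 1) → ℤ) (ρ : Fin (d + 1) → ℤ) (u' : Fin (d + 1) → ℤ) (κ' : Fin (d + 1)) :
    ∑ i ∈ s, divV (fun κ u => wilsonW₂ d (wsym22 N) κ u κ' u') (U i) =
      (4 * (N : ℝ) ^ 2) • conjV (wilsonA d κ' u') (diagK (∑ i ∈ s, legInd ρ (U i))) := by
  rw [conjV_diagK_sum, Finset.smul_sum]
  exact Finset.sum_congr rfl fun i _ => divV_wilsonW₂_wsym22_eq_conjV hτ ho hN c ρ u' κ' (U i)

end Law

end Summit.QuantumFields.BalabanUV.Beta.WilsonBiStencilWardZ
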